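import Summits.BirchSwinnertonDyer.BirchSwinnertonDyer.Theorems.AlignedTransportAtTwoMainConjectureOfRankZeroBSDAtTwoFineRoadKleinCohomology
import Summits.BirchSwinnertonDyer.BirchSwinnertonDyer.Theorems.ByReductionTypeAtTwoMultTransportKlein
import HarnessLib

/-!
# RIGIDITY of the Klein module: two actions of a group on Klein four-groups with the SAME KERNEL are equivariantly isomorphic
# (pure group theory; the reason why the `2`-division FIELD `K(E[2])` determines the Galois MODULE `E[2]`)

Cell `bsd-f1-sign2`, WIDTH-5 attach seat `bsd-line-att-p5` (gen 5) on line `birth` of crux C2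
stmt-BirchSwinnertonDyer-22298 `MainConjectureOfRankZeroBSDAtTwo`; group-theoretic input of `…FineRoadDivisionFieldRigidity` (att-p5 g5:
`K(E₁[2]) = K(E₂[2])` ⟹ `E₁[2] ≅ E₂[2]` `Γ_K`-equivariantly ⟹ (A)₂^{rel ∞}(E₁) ⟺ (A)₂^{rel ∞}(E₂)). A `--supports 22298 --as helper`
file. HONEST FRAMING: THEOREMS ONLY — no definition, no named fact, no `sorry`; BSD is NOT proved by any of this.

**`klein_exists_equivariant_addEquiv_of_ker_iff`.** Let a group `G` act on two Klein four-groups `V₁`, `V₂` (`#Vᵢ = 4`, `v + v = 0`)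
with the SAME KERNEL: an element acts trivially on `V₁` iff it acts trivially on `V₂`. Then there is a `G`-equivariant additive
isomorphism `V₁ ≃ V₂`. Equivalently: any two embeddings of a group into `Aut(V₄) ≅ S₃ ≅ GL₂(𝔽₂)` with the same kernel are conjugate
by an isomorphism `V₁ ≅ V₂` — every automorphism of `S₃`, of `A₃` inside `S₃`, and of a transposition subgroup is induced by
conjugation in `S₃`. Done by hand on the Klein four-group with b2b t42's `klein_cases` / `klein_exists_addEquiv` /
`klein_addMonoidHom_ext` and att-p3 g4's fixed-point-free calculus (`smul_smul_eq_add_of_fpf`: `σ² = 1 + σ`; `fpf_smul_dichotomy`: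
`A₃ ⊴ S₃`; `smul_eq_self_of_generators`): Case A — some `σ` is fixed-point-free on `V₁` (then on `V₂`; a `3`-cycle): match
`a₀, σ a₀ ↦ b₀, σ b₀`, with `a₀, b₀` the fixed vectors of one "transposition" `τ` when the image is all of `S₃`, and every `g` acts as a
word in `σ, τ` (`action_cases_of_fpf`); Case B — every element fixes a non-zero vector: then all non-trivial elements are ONE
transposition (two distinct transpositions compose to a `3`-cycle), match fixed and moved vectors. This rigidity is SPECIAL TO `p = 2`:
for odd `p` the field `ℚ(E[p])` does not determine `E[p]` (twists by characters of `Gal(ℚ(E[p])/ℚ)`).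

References: J.-P. Serre, Invent. Math. 15 (1972) §5.3 (`GL₂(𝔽₂) ≅ S₃`); the lead's CENSUS-lead-g4.md (O1) (crux workfile).
-/

set_option autoImplicit false
-- the Theorems namespace of this sub repeats the summit name by design (D-0017 nested layout)
set_option linter.dupNamespace false

open scoped Classical

namespace Summit.BirchSwinnertonDyer.BirchSwinnertonDyer.Theorems.AlignedTransportAtTwoFineRoad.KleinRigidity

open Summit.BirchSwinnertonDyer.BirchSwinnertonDyer.Theorems.MultTransportAtTwo
  Summit.BirchSwinnertonDyer.BirchSwinnertonDyer.Theorems.AlignedTransportAtTwoFineRoad.PerfectDescent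

section Klein

variable {G : Type*} [Group G] {V₁ : Type*} [AddCommGroup V₁] [DistribMulAction G V₁]
  {V₂ : Type*} [AddCommGroup V₂] [DistribMulAction G V₂]

/-! ## §1 Small tools on one Klein four-group with a `G`-action -/

omit [DistribMulAction G V₁] in
/-- In a Klein four-group, next to any element there is a non-zero element different from it. [folklore] -/
theorem klein_exists_ne_ne (h4 : Nat.card V₁ = 4) (a : V₁) : ∃ b : V₁, b ≠ 0 ∧ b ≠ a := by
  by_contra! h
  haveI : Finite V₁ := Nat.finite_of_card_ne_zero (by rw [h4]; norm_num)
  -- every element is `0` or `a`: `V₁` embeds in `Fin 2`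
  have hf : Function.Injective (fun v : V₁ ↦ if v = 0 then (0 : Fin 2) else 1) := by
    intro v w hvw
    by_cases hv : v = 0 <;> by_cases hw : w = 0
    · rw [hv, hw]
    · simp only [hv, hw, if_true, if_false] at hvw; exact absurd hvw Fin.zero_ne_one
    · simp only [hv, hw, if_true, if_false] at hvw; exact absurd hvw.symm Fin.zero_ne_one
    · rw [h v hv, h w hw]
  have hle := Nat.card_le_card_of_injective _ hf
  rw [h4, Nat.card_eq_fintype_card, Fintype.card_fin] at hle
  omega

omit [DistribMulAction G V₂] in
/-- `1 + σ + σ² = 0`, solved for `σ³`: a fixed-point-free `σ` has `σ • σ • σ • v = v`. [folklore] -/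
theorem smul_smul_smul_eq_self_of_fpf (h4 : Nat.card V₁ = 4) (h2 : ∀ v : V₁, v + v = 0) {σ : G}
    (hσ : ∀ v : V₁, σ • v = v → v = 0) (v : V₁) : σ • σ • σ • v = v := by
  rw [smul_smul_eq_add_of_fpf h4 h2 hσ (σ • v), smul_smul_eq_add_of_fpf h4 h2 hσ v, add_left_comm, h2, add_zero]

omit [DistribMulAction G V₂] in
/-- An element fixing a NON-ZERO vector of a Klein four-group acts as an involution: `τ • τ • v = v` (it is the identity or the
transposition of the two other non-zero vectors). [folklore] -/
theorem smul_smul_eq_self_of_fixed (h4 : Nat.card V₁ = 4) (h2 : ∀ v : V₁, v + v = 0) {τ : G} {w : V₁} (hw : w ≠ 0)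
    (hτw : τ • w = w) (v : V₁) : τ • τ • v = v := by
  obtain ⟨w', hw'0, hw'w⟩ := klein_exists_ne_ne h4 w
  have hτw'0 : τ • w' ≠ 0 := fun h ↦ hw'0 ((smul_eq_zero_iff_eq τ).mp h)
  have hτw'w : τ • w' ≠ w := fun h ↦ hw'w (smul_left_cancel τ (h.trans hτw.symm))
  rcases klein_cases h4 h2 hw hw'0 (Ne.symm hw'w) (τ • w') with h | h | h | h
  · exact absurd h hτw'0
  · exact absurd h hτw'w
  · have htriv : ∀ u : V₁, τ • u = u := smul_eq_self_of_generators h4 h2 hw hw'0 (Ne.symm hw'w) hτw h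
    rw [htriv, htriv]
  · have hτ2w' : (τ * τ) • w' = w' := by rw [mul_smul, h, smul_add, hτw, h, ← add_assoc, h2, zero_add]
    have hτ2w : (τ * τ) • w = w := by rw [mul_smul, hτw, hτw]
    rw [← mul_smul]
    exact smul_eq_self_of_generators h4 h2 hw hw'0 (Ne.symm hw'w) hτ2w hτ2w' v

omit [DistribMulAction G V₂] in
/-- A NON-TRIVIAL element whose square acts trivially on a Klein four-group fixes a non-zero vector (a fixed-point-free element
has `σ² = 1 + σ ≠ 1`). [folklore] -/
theorem exists_fixed_of_smul_smul_eq_self (h4 : Nat.card V₁ = 4) (h2 : ∀ v : V₁, v + v = 0) {τ : G}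
    (hτ2 : ∀ v : V₁, τ • τ • v = v) (hτ : ∃ v : V₁, τ • v ≠ v) : ∃ w : V₁, w ≠ 0 ∧ τ • w = w := by
  by_contra! hfpf
  have hfpf' : ∀ v : V₁, τ • v = v → v = 0 := fun v hv ↦ by_contra fun h ↦ hfpf v h hv
  obtain ⟨v, hv⟩ := hτ
  have h := smul_smul_eq_add_of_fpf h4 h2 hfpf' v
  rw [hτ2 v] at h
  have h0 : τ • v = 0 := by
    have e := congrArg (fun x ↦ v + x) h
    rw [← add_assoc, h2, zero_add] at e
    exact e.symm
  have hv0 : v = 0 := (smul_eq_zero_iff_eq τ).mp h0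
  exact hv (by rw [hv0, smul_zero])

omit [DistribMulAction G V₂] in
/-- A "transposition" moves the non-fixed vectors to their sum with the fixed one: if `τ a₀ = a₀ ≠ 0` and `τ a₁ ≠ a₁` then
`τ • a₁ = a₀ + a₁`. [folklore] -/
theorem smul_eq_add_of_fixed_of_ne (h4 : Nat.card V₁ = 4) (h2 : ∀ v : V₁, v + v = 0) {τ : G} {a₀ a₁ : V₁} (ha₀ : a₀ ≠ 0)
    (hτa₀ : τ • a₀ = a₀) (hτa₁ : τ • a₁ ≠ a₁) : τ • a₁ = a₀ + a₁ := by
  have ha₁ : a₁ ≠ 0 := fun h ↦ hτa₁ (by rw [h, smul_zero])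
  have h01 : a₀ ≠ a₁ := fun h ↦ hτa₁ (by rw [← h, hτa₀])
  rcases klein_cases h4 h2 ha₀ ha₁ h01 (τ • a₁) with h | h | h | h
  · exact absurd ((smul_eq_zero_iff_eq τ).mp h) ha₁
  · exact absurd (smul_left_cancel τ (h.trans hτa₀.symm)) (Ne.symm h01)
  · exact absurd h hτa₁
  · exact h

omit [DistribMulAction G V₂] in
/-- **Where can `g` send the frame `a₀, σ a₀`?** For a fixed-point-free `σ` and `a₀ ≠ 0`, every `g ∈ G` acts on `V₁` like `1`, `σ` or
`σ²`, or else like a "transposition composed with a power of `σ`": one of `g a₀ = a₀ ∧ g σa₀ = a₀ + σa₀`,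
`g a₀ = σ a₀ ∧ g σa₀ = a₀`, `g a₀ = σ²a₀ ∧ g σa₀ = σ a₀` (the six elements of `S₃`). [folklore] -/
theorem action_cases_of_fpf (h4 : Nat.card V₁ = 4) (h2 : ∀ v : V₁, v + v = 0) {σ : G}
    (hσ : ∀ v : V₁, σ • v = v → v = 0) {a₀ : V₁} (ha₀ : a₀ ≠ 0) (g : G) :
    (∀ v : V₁, g • v = v) ∨ (∀ v : V₁, g • v = σ • v) ∨ (∀ v : V₁, g • v = (σ * σ) • v) ∨
      (g • a₀ = a₀ ∧ g • σ • a₀ = a₀ + σ • a₀) ∨ (g • a₀ = σ • a₀ ∧ g • σ • a₀ = a₀) ∨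
      (g • a₀ = σ • σ • a₀ ∧ g • σ • a₀ = σ • a₀) := by
  have hσa0 : σ • a₀ ≠ 0 := fun h ↦ ha₀ ((smul_eq_zero_iff_eq σ).mp h)
  have hσa : σ • a₀ ≠ a₀ := fun h ↦ ha₀ (hσ a₀ h)
  have hss : σ • σ • a₀ = a₀ + σ • a₀ := smul_smul_eq_add_of_fpf h4 h2 hσ a₀
  have hga0 : g • a₀ ≠ 0 := fun h ↦ ha₀ ((smul_eq_zero_iff_eq g).mp h)
  have hgσa0 : g • σ • a₀ ≠ 0 := fun h ↦ hσa0 ((smul_eq_zero_iff_eq g).mp h)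
  have hinj : g • σ • a₀ ≠ g • a₀ := fun h ↦ hσa (smul_left_cancel g h)
  have gen := fun (r : G) (hqa : g • a₀ = r • a₀) (hqb : g • σ • a₀ = r • σ • a₀) ↦
    smul_eq_smul_of_generators h4 h2 ha₀ hσa0 (Ne.symm hσa) hqa hqb
  rcases klein_cases h4 h2 ha₀ hσa0 (Ne.symm hσa) (g • a₀) with h | h | h | h
  · exact absurd h hga0
  · -- `g a₀ = a₀`
    rcases klein_cases h4 h2 ha₀ hσa0 (Ne.symm hσa) (g • σ • a₀) with h' | h' | h' | h'
    · exact absurd h' hgσa0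
    · exact absurd (h'.trans h.symm) hinj
    · exact Or.inl (smul_eq_self_of_generators h4 h2 ha₀ hσa0 (Ne.symm hσa) h h')
    · exact Or.inr (Or.inr (Or.inr (Or.inl ⟨h, h'⟩)))
  · -- `g a₀ = σ a₀`
    rcases klein_cases h4 h2 ha₀ hσa0 (Ne.symm hσa) (g • σ • a₀) with h' | h' | h' | h'
    · exact absurd h' hgσa0
    · exact Or.inr (Or.inr (Or.inr (Or.inr (Or.inl ⟨h, h'⟩))))
    · exact absurd (h'.trans h.symm) hinj
    · exact Or.inr (Or.inl (gen σ h (by rw [h', hss])))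
  · -- `g a₀ = a₀ + σ a₀ = σ² a₀`
    rcases klein_cases h4 h2 ha₀ hσa0 (Ne.symm hσa) (g • σ • a₀) with h' | h' | h' | h'
    · exact absurd h' hgσa0
    · refine Or.inr (Or.inr (Or.inl (gen (σ * σ) (by rw [mul_smul, hss, h]) ?_)))
      rw [h', mul_smul, smul_smul_smul_eq_self_of_fpf h4 h2 hσ]
    · exact Or.inr (Or.inr (Or.inr (Or.inr (Or.inr ⟨by rw [h, hss], h'⟩))))
    · exact absurd (h'.trans h.symm) hinj

/-! ## §2 Equivariance bookkeeping for an additive isomorphism `e : V₁ ≃ V₂` -/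

/-- Equivariance of `e` for `g` is checked on two generators. [folklore] -/
theorem equivariant_of_generators (h4 : Nat.card V₁ = 4) (h2 : ∀ v : V₁, v + v = 0) (e : V₁ ≃+ V₂) {a b : V₁} (ha : a ≠ 0)
    (hb : b ≠ 0) (hab : a ≠ b) {g : G} (hga : e (g • a) = g • e a) (hgb : e (g • b) = g • e b) (v : V₁) :
    e (g • v) = g • e v := by
  have key := klein_addMonoidHom_ext h4 h2 ha hb hab
    (f := e.toAddMonoidHom.comp (DistribSMul.toAddMonoidHom V₁ g))
    (g := (DistribSMul.toAddMonoidHom V₂ g).comp e.toAddMonoidHom) hga hgb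
  exact congrArg (fun f : V₁ →+ V₂ ↦ f v) key

/-- Transfer along the common kernel: if `g` and `s` act identically on `V₁` (so `s⁻¹ g` lies in the kernel and acts trivially on
`V₂` too) and `e` is `s`-equivariant, then `e` is `g`-equivariant. [folklore] -/
theorem equivariant_of_smul_eq_smul (hker : ∀ g : G, (∀ v : V₁, g • v = v) ↔ (∀ w : V₂, g • w = w)) (e : V₁ ≃+ V₂) {g s : G}
    (hs : ∀ v : V₁, e (s • v) = s • e v) (hgs : ∀ v : V₁, g • v = s • v) (v : V₁) : e (g • v) = g • e v := by
  have h1 : ∀ u : V₁, (s⁻¹ * g) • u = u := fun u ↦ by rw [mul_smul, hgs, inv_smul_smul]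
  have h3 : g • e v = s • e v := by
    calc g • e v = s • (s⁻¹ * g) • e v := by rw [mul_smul, smul_inv_smul]
      _ = s • e v := by rw [(hker _).1 h1]
  rw [hgs, hs, h3]

/-- Equivariance is multiplicative in the group element. [folklore] -/
theorem equivariant_mul (e : V₁ ≃+ V₂) {s t : G} (hs : ∀ v : V₁, e (s • v) = s • e v) (ht : ∀ v : V₁, e (t • v) = t • e v)
    (v : V₁) : e ((s * t) • v) = (s * t) • e v := by
  rw [mul_smul, hs, ht, mul_smul]

/-! ## §3 The rigidity theorem -/

/-- **RIGIDITY OF THE KLEIN MODULE.** Let a group `G` act on two Klein four-groups `V₁`, `V₂` (`#Vᵢ = 4`, `v + v = 0`) with the SAME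
KERNEL (`g` acts trivially on `V₁` iff it acts trivially on `V₂`). Then there is a `G`-EQUIVARIANT additive isomorphism `V₁ ≃ V₂`.
(Any two embeddings of a group into `Aut(V₄) ≅ S₃` with the same kernel differ by an inner automorphism of `S₃`.) Proof by the case
analysis of the module docstring. [cite: Serre1972, §5.3 (`GL₂(𝔽₂) ≅ S₃` acting on `E[2]`)] -/
theorem klein_exists_equivariant_addEquiv_of_ker_iff (h4 : Nat.card V₁ = 4) (h2 : ∀ v : V₁, v + v = 0)
    (h4' : Nat.card V₂ = 4) (h2' : ∀ w : V₂, w + w = 0)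
    (hker : ∀ g : G, (∀ v : V₁, g • v = v) ↔ (∀ w : V₂, g • w = w)) :
    ∃ e : V₁ ≃+ V₂, ∀ (g : G) (v : V₁), e (g • v) = g • e v := by
  -- kernel elements are equivariant for ANY `e`
  have hN : ∀ (e : V₁ ≃+ V₂) {g : G}, (∀ v : V₁, g • v = v) → ∀ v : V₁, e (g • v) = g • e v := fun e g hg v ↦ by
    rw [hg, (hker g).1 hg]
  -- squares: `τ² = 1` on `V₁` iff on `V₂`
  have hsq : ∀ {τ : G}, (∀ v : V₁, τ • τ • v = v) → ∀ w : V₂, τ • τ • w = w := fun {τ} hτ w ↦ by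
    have h := (hker (τ * τ)).1 (fun v ↦ by rw [mul_smul]; exact hτ v)
    rw [← mul_smul]; exact h w
  -- non-triviality transfers
  have hnt : ∀ {τ : G}, (∃ v : V₁, τ • v ≠ v) → ∃ w : V₂, τ • w ≠ w := fun {τ} ⟨v, hv⟩ ↦ by
    by_contra! h
    exact hv ((hker τ).2 h v)
  by_cases hA : ∃ σ : G, ∀ v : V₁, σ • v = v → v = 0
  · /- Case A: a fixed-point-free `σ`; it is fixed-point-free on `V₂` as well -/
    obtain ⟨σ, hσ⟩ := hA
    have hσ' : ∀ w : V₂, σ • w = w → w = 0 := by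
      intro w hw
      by_contra hw0
      have hσ2 : ∀ v : V₁, σ • σ • v = v := by
        have h := (hker (σ * σ)).2 (fun u ↦ by rw [mul_smul]; exact smul_smul_eq_self_of_fixed h4' h2' hw0 hw u)
        intro v; rw [← mul_smul]; exact h v
      obtain ⟨a, ha⟩ := klein_exists_ne_zero (M := V₁) h4
      have h := smul_smul_eq_add_of_fpf h4 h2 hσ a
      rw [hσ2 a] at h
      have h0 : σ • a = 0 := by
        have e := congrArg (fun x ↦ a + x) h
        rw [← add_assoc, h2, zero_add] at e
        exact e.symm
      exact ha ((smul_eq_zero_iff_eq σ).mp h0)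
    have hss : ∀ v : V₁, σ • σ • v = v + σ • v := smul_smul_eq_add_of_fpf h4 h2 hσ
    have hss' : ∀ w : V₂, σ • σ • w = w + σ • w := smul_smul_eq_add_of_fpf h4' h2' hσ'
    have hsss : ∀ v : V₁, σ • σ • σ • v = v := smul_smul_smul_eq_self_of_fpf h4 h2 hσ
    -- the frame `a₀, σ a₀ ↦ b₀, σ b₀` gives a `σ`-equivariant isomorphism, for ANY non-zero `a₀, b₀`
    have hframe : ∀ {a₀ : V₁} {b₀ : V₂}, a₀ ≠ 0 → b₀ ≠ 0 → ∃ e : V₁ ≃+ V₂, e a₀ = b₀ ∧ e (σ • a₀) = σ • b₀ ∧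
        ∀ v : V₁, e (σ • v) = σ • e v := by
      intro a₀ b₀ ha₀ hb₀
      have hσa0 : σ • a₀ ≠ 0 := fun h ↦ ha₀ ((smul_eq_zero_iff_eq σ).mp h)
      have hσa : σ • a₀ ≠ a₀ := fun h ↦ ha₀ (hσ a₀ h)
      have hσb0 : σ • b₀ ≠ 0 := fun h ↦ hb₀ ((smul_eq_zero_iff_eq σ).mp h)
      have hσb : σ • b₀ ≠ b₀ := fun h ↦ hb₀ (hσ' b₀ h)
      obtain ⟨e, hea, heb⟩ := klein_exists_addEquiv h4 h2 h4' h2' ha₀ hσa0 (Ne.symm hσa) hb₀ hσb0 (Ne.symm hσb)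
      refine ⟨e, hea, heb, equivariant_of_generators h4 h2 e ha₀ hσa0 (Ne.symm hσa) (by rw [heb, hea]) ?_⟩
      rw [hss, map_add, hea, heb, hss']
    by_cases hT : ∃ τ : G, (∃ v : V₁, τ • v ≠ v) ∧ ∃ v : V₁, v ≠ 0 ∧ τ • v = v
    · /- Case A1: the image is `S₃`; base the frame at the fixed vectors of the transposition `τ` -/
      obtain ⟨τ, hτnt, a₀, ha₀, hτa₀⟩ := hT
      have hτ2 : ∀ v : V₁, τ • τ • v = v := smul_smul_eq_self_of_fixed h4 h2 ha₀ hτa₀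
      obtain ⟨b₀, hb₀, hτb₀⟩ := exists_fixed_of_smul_smul_eq_self h4' h2' (hsq hτ2) (hnt hτnt)
      obtain ⟨e, hea, heb, heσ⟩ := hframe ha₀ hb₀
      have hσa0 : σ • a₀ ≠ 0 := fun h ↦ ha₀ ((smul_eq_zero_iff_eq σ).mp h)
      have hσa : σ • a₀ ≠ a₀ := fun h ↦ ha₀ (hσ a₀ h)
      -- `τ` moves `σ a₀` (else it would be trivial) to `a₀ + σ a₀`; same on `V₂`
      have hτσa : τ • σ • a₀ = a₀ + σ • a₀ := by
        refine smul_eq_add_of_fixed_of_ne h4 h2 ha₀ hτa₀ fun h ↦ ?_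
        obtain ⟨v, hv⟩ := hτnt
        exact hv (smul_eq_self_of_generators h4 h2 ha₀ hσa0 (Ne.symm hσa) hτa₀ h v)
      have hτσb : τ • σ • b₀ = b₀ + σ • b₀ := by
        have hσb0 : σ • b₀ ≠ 0 := fun h ↦ hb₀ ((smul_eq_zero_iff_eq σ).mp h)
        have hσb : σ • b₀ ≠ b₀ := fun h ↦ hb₀ (hσ' b₀ h)
        refine smul_eq_add_of_fixed_of_ne h4' h2' hb₀ hτb₀ fun h ↦ ?_
        obtain ⟨w, hw⟩ := hnt hτnt
        exact hw (smul_eq_self_of_generators h4' h2' hb₀ hσb0 (Ne.symm hσb) hτb₀ h w)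
      have heτ : ∀ v : V₁, e (τ • v) = τ • e v :=
        equivariant_of_generators h4 h2 e ha₀ hσa0 (Ne.symm hσa) (by rw [hτa₀, hea, hτb₀])
          (by rw [hτσa, map_add, hea, heb, hτσb])
      refine ⟨e, fun g ↦ ?_⟩
      rcases action_cases_of_fpf h4 h2 hσ ha₀ g with h | h | h | ⟨h1, h1'⟩ | ⟨h1, h1'⟩ | ⟨h1, h1'⟩
      · exact hN e h
      · exact equivariant_of_smul_eq_smul hker e heσ h
      · exact equivariant_of_smul_eq_smul hker e (equivariant_mul e heσ heσ) h
      · -- `g ≡ τ`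
        refine equivariant_of_smul_eq_smul hker e heτ (smul_eq_smul_of_generators h4 h2 ha₀ hσa0 (Ne.symm hσa) ?_ ?_)
        · rw [h1, hτa₀]
        · rw [h1', hτσa]
      · -- `g ≡ σ τ`
        refine equivariant_of_smul_eq_smul hker e (equivariant_mul e heσ heτ)
          (smul_eq_smul_of_generators h4 h2 ha₀ hσa0 (Ne.symm hσa) ?_ ?_)
        · rw [h1, mul_smul, hτa₀]
        · rw [h1', mul_smul, hτσa, smul_add, hss, ← add_assoc, add_comm (σ • a₀) a₀, add_assoc, h2, add_zero]
      · -- `g ≡ σ σ τ`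
        refine equivariant_of_smul_eq_smul hker e (equivariant_mul e heσ (equivariant_mul e heσ heτ))
          (smul_eq_smul_of_generators h4 h2 ha₀ hσa0 (Ne.symm hσa) ?_ ?_)
        · rw [h1, mul_smul, mul_smul, hτa₀]
        · rw [h1', mul_smul, mul_smul, hτσa, smul_add, smul_add, hsss, hss, add_comm a₀, add_assoc, h2, add_zero]
    · /- Case A2: the image is `A₃`; any frame works -/
      obtain ⟨a₀, ha₀⟩ := klein_exists_ne_zero (M := V₁) h4
      obtain ⟨b₀, hb₀⟩ := klein_exists_ne_zero (M := V₂) h4'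
      obtain ⟨e, hea, heb, heσ⟩ := hframe ha₀ hb₀
      have hσa0 : σ • a₀ ≠ 0 := fun h ↦ ha₀ ((smul_eq_zero_iff_eq σ).mp h)
      have hσa : σ • a₀ ≠ a₀ := fun h ↦ ha₀ (hσ a₀ h)
      have hsum : a₀ + σ • a₀ ≠ σ • a₀ := fun h ↦ ha₀ (by
        have e := congrArg (· + σ • a₀) h
        simp only [add_assoc, h2, add_zero] at e
        exact e)
      refine ⟨e, fun g ↦ ?_⟩
      rcases action_cases_of_fpf h4 h2 hσ ha₀ g with h | h | h | ⟨h1, h1'⟩ | ⟨h1, h1'⟩ | ⟨h1, h1'⟩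
      · exact hN e h
      · exact equivariant_of_smul_eq_smul hker e heσ h
      · exact equivariant_of_smul_eq_smul hker e (equivariant_mul e heσ heσ) h
      · -- `g` is a transposition fixing `a₀`: excluded
        exact absurd ⟨g, ⟨σ • a₀, by rw [h1']; exact hsum⟩, a₀, ha₀, h1⟩ hT
      · -- `σ² g` is a transposition fixing `a₀`: excluded
        refine absurd ⟨σ * σ * g, ⟨σ • a₀, ?_⟩, a₀, ha₀, ?_⟩ hT
        · rw [mul_smul, mul_smul, h1', hss]; exact hsum
        · rw [mul_smul, mul_smul, h1, hsss]
      · -- `σ g` is a transposition fixing `a₀`: excluded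
        refine absurd ⟨σ * g, ⟨σ • a₀, ?_⟩, a₀, ha₀, ?_⟩ hT
        · rw [mul_smul, h1', hss]; exact hsum
        · rw [mul_smul, h1, hsss]
  · /- Case B: every element fixes a non-zero vector of `V₁` -/
    push Not at hA
    by_cases hT : ∃ τ : G, ∃ v : V₁, τ • v ≠ v
    · /- Case B1: the image is a transposition subgroup `{1, τ}` -/
      obtain ⟨τ, a₁, hτa₁⟩ := hT
      obtain ⟨a₀, hτa₀, ha₀⟩ := hA τ
      have hτ2 : ∀ v : V₁, τ • τ • v = v := smul_smul_eq_self_of_fixed h4 h2 ha₀ hτa₀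
      obtain ⟨b₀, hb₀, hτb₀⟩ := exists_fixed_of_smul_smul_eq_self h4' h2' (hsq hτ2) (hnt ⟨a₁, hτa₁⟩)
      obtain ⟨b₁, hτb₁⟩ := hnt ⟨a₁, hτa₁⟩
      have ha₁ : a₁ ≠ 0 := fun h ↦ hτa₁ (by rw [h, smul_zero])
      have h01 : a₀ ≠ a₁ := fun h ↦ hτa₁ (by rw [← h, hτa₀])
      have hb₁ : b₁ ≠ 0 := fun h ↦ hτb₁ (by rw [h, smul_zero])
      have h01' : b₀ ≠ b₁ := fun h ↦ hτb₁ (by rw [← h, hτb₀])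
      have hτa₁' : τ • a₁ = a₀ + a₁ := smul_eq_add_of_fixed_of_ne h4 h2 ha₀ hτa₀ hτa₁
      have hτb₁' : τ • b₁ = b₀ + b₁ := smul_eq_add_of_fixed_of_ne h4' h2' hb₀ hτb₀ hτb₁
      obtain ⟨e, hea, heb⟩ := klein_exists_addEquiv h4 h2 h4' h2' ha₀ ha₁ h01 hb₀ hb₁ h01'
      have heτ : ∀ v : V₁, e (τ • v) = τ • e v :=
        equivariant_of_generators h4 h2 e ha₀ ha₁ h01 (by rw [hτa₀, hea, hτb₀]) (by rw [hτa₁', map_add, hea, heb, hτb₁'])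
      refine ⟨e, fun g ↦ ?_⟩
      by_cases hg : ∀ v : V₁, g • v = v
      · exact hN e hg
      -- `g` is non-trivial with a fixed vector `a'`; it must be `a₀`, else `τ g` is fixed-point-free
      push Not at hg
      obtain ⟨a', hga', ha'⟩ := hA g
      have ha'eq : a' = a₀ := by
        by_contra hne
        -- the three non-zero vectors are `a₀, a', a₀ + a'`
        have hτa' : τ • a' = a₀ + a' := by
          refine smul_eq_add_of_fixed_of_ne h4 h2 ha₀ hτa₀ fun h ↦ hτa₁ ?_
          exact smul_eq_self_of_generators h4 h2 ha₀ ha' (Ne.symm hne) hτa₀ h a₁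
        have hga₀ : g • a₀ = a' + a₀ := by
          refine smul_eq_add_of_fixed_of_ne h4 h2 ha' hga' fun h ↦ ?_
          obtain ⟨v, hv⟩ := hg
          exact hv (smul_eq_self_of_generators h4 h2 ha' ha₀ hne hga' h v)
        -- `τ g` is fixed-point-free: contradiction with Case B
        obtain ⟨u, hu, hu0⟩ := hA (τ * g)
        rcases klein_cases h4 h2 ha₀ ha' (Ne.symm hne) u with h | h | h | h
        · exact hu0 h
        · -- `τ g a₀ = τ (a' + a₀) = a₀ + a' + a₀ = a'`
          rw [h, mul_smul, hga₀, smul_add, hτa', hτa₀, add_comm a₀ a', add_assoc, h2, add_zero] at hu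
          exact hne hu
        · -- `τ g a' = τ a' = a₀ + a'`
          rw [h, mul_smul, hga', hτa'] at hu
          exact ha₀ (by simpa using hu)
        · -- `τ g (a₀ + a') = τ (a' + a₀ + a') = τ a₀ = a₀`
          rw [h, mul_smul, smul_add, hga₀, hga', add_comm a' a₀, add_assoc, h2, add_zero, hτa₀] at hu
          exact ha' (by simpa using hu.symm)
      have hga₀ : g • a₀ = a₀ := by rw [← ha'eq]; exact hga'
      have hga₁ : g • a₁ = a₀ + a₁ := by
        refine smul_eq_add_of_fixed_of_ne h4 h2 ha₀ hga₀ fun h ↦ ?_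
        obtain ⟨v, hv⟩ := hg
        exact hv (smul_eq_self_of_generators h4 h2 ha₀ ha₁ h01 hga₀ h v)
      exact equivariant_of_smul_eq_smul hker e heτ
        (smul_eq_smul_of_generators h4 h2 ha₀ ha₁ h01 (by rw [hga₀, hτa₀]) (by rw [hga₁, hτa₁']))
    · /- Case B2: `G` acts trivially on `V₁`, hence on `V₂`: any isomorphism is equivariant -/
      push Not at hT
      obtain ⟨a₀, ha₀⟩ := klein_exists_ne_zero (M := V₁) h4
      obtain ⟨a₁, ha₁, h01⟩ := klein_exists_ne_ne h4 a₀
      obtain ⟨b₀, hb₀⟩ := klein_exists_ne_zero (M := V₂) h4'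
      obtain ⟨b₁, hb₁, h01'⟩ := klein_exists_ne_ne h4' b₀
      obtain ⟨e, -, -⟩ := klein_exists_addEquiv h4 h2 h4' h2' ha₀ ha₁ (Ne.symm h01) hb₀ hb₁ (Ne.symm h01')
      exact ⟨e, fun g ↦ hN e (hT g)⟩

end Klein

end Summit.BirchSwinnertonDyer.BirchSwinnertonDyer.Theorems.AlignedTransportAtTwoFineRoad.KleinRigidity
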